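import Mathlib
import HarnessLib

/-!
# ValiantsHypothesis / MonotoneRestoration — `MonotoneRestorationQP`, line `Sketch`, stub G2

Support file for crux item `stmt-ValiantsHypothesis-15886`
(`Summit.ValiantsHypothesis.ValiantsHypothesis.Theses.MonotoneRestoration.MonotoneRestorationQP`),
line `Sketch`, stub `stub_altFixing_orbit_dichotomy` (small orbits of `Alt([n] ∖ X)` are points).

Let `X ⊆ [n]` with `|X| + 9 ≤ n`, let `A_X` be the group of even permutations of `[n]` fixing `X`
pointwise, acting on `K[x_{ij}]` by renaming along the diagonal `(i, j) ↦ (ρ i, ρ j)`.  If the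
`A_X`-orbit of a polynomial `q` is contained in a finite set `T` with `|T| + |X| < n`, then `q` is
fixed by `A_X`.

Proof: restricting to `Ω := [n] ∖ X` identifies `A_X` with `Alt(Ω)`, `|Ω| = n - |X| ≥ 9`.  The
stabiliser `S ≤ Alt(Ω)` of `q` has index `|orbit| ≤ |T| < |Ω|`.  Its normal core `N` is normal
in the simple group `Alt(Ω)` (Mathlib's `alternatingGroup.normal_subgroup_eq_bot_or_eq_top`),
and `[Alt(Ω) : N]` divides `[Alt(Ω) : S]! ≤ (|Ω| - 1)!`, so `N ≠ 1` (as `|Alt(Ω)| = |Ω|!/2 >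
(|Ω| - 1)!`); hence `N = Alt(Ω)`, `S = Alt(Ω)`, and every element of `A_X` fixes `q`.
-/

-- `Summit.ValiantsHypothesis.ValiantsHypothesis.…` is the tree's mandated single-conjunct layout
-- (Sub = Summit), so the duplicated namespace component is intended.
set_option linter.dupNamespace false

namespace Summit.ValiantsHypothesis.ValiantsHypothesis.Theorems

open MvPolynomial Equiv Equiv.Perm

/-- A subgroup of the alternating group `Alt(Ω)`, `|Ω| ≥ 5`, of index smaller than `|Ω|` is the
whole group (via simplicity of `Alt(Ω)` and the normal core). [folklore] -/
theorem altOrbit_subgroup_alternatingGroup_eq_top_of_index_lt {Ω : Type*} [Fintype Ω]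
    [DecidableEq Ω] (h5 : 5 ≤ Fintype.card Ω) (S : Subgroup ↥(alternatingGroup Ω))
    (hS : S.index < Fintype.card Ω) : S = ⊤ := by
  have hΩ : 5 ≤ Nat.card Ω := by rwa [Nat.card_eq_fintype_card]
  haveI : Nontrivial Ω := Fintype.one_lt_card_iff_nontrivial.mp (by omega)
  rcases alternatingGroup.normal_subgroup_eq_bot_or_eq_top hΩ (N := S.normalCore) with h | h
  · exfalso
    have hdvd : S.normalCore.index ∣ (S.index).factorial := by
      rw [Subgroup.normalCore_eq_ker, Subgroup.index_ker, Subgroup.index_eq_card (H := S),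
        ← Nat.card_perm]
      exact Subgroup.card_subgroup_dvd_card (MulAction.toPermHom _ _).range
    rw [h, Subgroup.index_bot] at hdvd
    have h2 := two_mul_nat_card_alternatingGroup (α := Ω)
    rw [Nat.card_perm, Nat.card_eq_fintype_card (α := Ω)] at h2
    have hle : Nat.card ↥(alternatingGroup Ω) ≤ (Fintype.card Ω - 1).factorial :=
      (Nat.le_of_dvd (Nat.factorial_pos _) hdvd).trans (Nat.factorial_le (by omega))
    have key : Fintype.card Ω * (Fintype.card Ω - 1).factorial ≤
        2 * (Fintype.card Ω - 1).factorial := by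
      rw [Nat.mul_factorial_pred (by omega), ← h2]; omega
    have := Nat.le_of_mul_le_mul_right key (Nat.factorial_pos _)
    omega
  · rw [eq_top_iff, ← h]
    exact S.normalCore_le

/-- If `Perm Ω` (`|Ω| ≥ 5`) acts on `β` and the images of `b` under the even permutations lie in a
finite set of fewer than `|Ω|` elements, then every even permutation fixes `b`. [folklore] -/
theorem altOrbit_smul_eq_of_alternating_orbit_small {Ω β : Type*} [Fintype Ω] [DecidableEq Ω]
    [MulAction (Perm Ω) β] (h5 : 5 ≤ Fintype.card Ω) (b : β) (T : Finset β)
    (hT : T.card < Fintype.card Ω) (horb : ∀ τ : Perm Ω, sign τ = 1 → τ • b ∈ T) :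
    ∀ τ : Perm Ω, sign τ = 1 → τ • b = b := by
  intro τ hτ
  have horbT : MulAction.orbit ↥(alternatingGroup Ω) b ⊆ ↑T := by
    rintro _ ⟨a, rfl⟩
    simp only [Finset.mem_coe, Subgroup.smul_def]
    exact horb _ (mem_alternatingGroup.mp a.2)
  have hidx : (MulAction.stabilizer ↥(alternatingGroup Ω) b).index < Fintype.card Ω := by
    rw [MulAction.index_stabilizer]
    exact ((Set.ncard_le_ncard horbT T.finite_toSet).trans_eq (Set.ncard_coe_finset T)).trans_lt hT
  have htop := altOrbit_subgroup_alternatingGroup_eq_top_of_index_lt h5 _ hidx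
  have hmem : (⟨τ, mem_alternatingGroup.mpr hτ⟩ : ↥(alternatingGroup Ω)) ∈
      MulAction.stabilizer ↥(alternatingGroup Ω) b := by
    rw [htop]; exact Subgroup.mem_top _
  simpa [MulAction.mem_stabilizer_iff, Subgroup.mk_smul] using hmem

/-- Renaming along the diagonal map of a product of permutations is the composite renaming.
[folklore] -/
theorem altOrbit_rename_diag_mul {n : ℕ} {K : Type} [CommSemiring K] (σ τ : Perm (Fin n))
    (f : MvPolynomial (Fin n × Fin n) K) :
    rename (fun p : Fin n × Fin n => ((σ * τ) p.1, (σ * τ) p.2)) f =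
      rename (fun p : Fin n × Fin n => (σ p.1, σ p.2))
        (rename (fun p : Fin n × Fin n => (τ p.1, τ p.2)) f) := by
  rw [rename_rename]
  rfl

/-- Renaming along the diagonal map of the identity permutation is the identity. [folklore] -/
theorem altOrbit_rename_diag_one {n : ℕ} {K : Type} [CommSemiring K]
    (f : MvPolynomial (Fin n × Fin n) K) :
    rename (fun p : Fin n × Fin n => ((1 : Perm (Fin n)) p.1, (1 : Perm (Fin n)) p.2)) f = f := by
  have : (fun p : Fin n × Fin n => ((1 : Perm (Fin n)) p.1, (1 : Perm (Fin n)) p.2)) = id := by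
    funext p; rfl
  rw [this, rename_id_apply]

/-- **Stub G2 (orbit dichotomy for `Alt`-fixing groups).**  Let `X ⊆ [n]` with `|X| + 9 ≤ n` and
let `A_X` be the group of even permutations of `[n]` fixing `X` pointwise, acting on polynomials in
the matrix variables `x_{ij}` by renaming along the diagonal `(i, j) ↦ (ρ i, ρ j)`.  If the
`A_X`-orbit of `q` is contained in a finite set `T` with `|T| + |X| < n`, then `q` is `A_X`-fixed:
`A_X ≅ Alt([n] ∖ X)` has no proper subgroup of index `< n - |X|` (the case `k = 1` of
Dixon–Mortimer, *Permutation Groups*, Thm 5.2B; proved here from the simplicity of `Alt(Ω)`,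
`altOrbit_subgroup_alternatingGroup_eq_top_of_index_lt`), so an orbit of size `< n - |X|` is a
point. [folklore] -/
theorem stub_altFixing_orbit_dichotomy {n : ℕ} {K : Type} [CommSemiring K]
    (q : MvPolynomial (Fin n × Fin n) K) (X : Finset (Fin n)) (h8 : X.card + 9 ≤ n)
    (T : Finset (MvPolynomial (Fin n × Fin n) K)) (hT : T.card + X.card < n)
    (horb : ∀ ρ : Equiv.Perm (Fin n), (∀ x ∈ X, ρ x = x) → Equiv.Perm.sign ρ = 1 →
      MvPolynomial.rename (fun p : Fin n × Fin n => (ρ p.1, ρ p.2)) q ∈ T) :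
    ∀ ρ : Equiv.Perm (Fin n), (∀ x ∈ X, ρ x = x) → Equiv.Perm.sign ρ = 1 →
      MvPolynomial.rename (fun p : Fin n × Fin n => (ρ p.1, ρ p.2)) q = q := by
  intro ρ hρX hρs
  -- the action of `Perm (Fin n)` on polynomials by renaming along the diagonal
  letI instFin : MulAction (Perm (Fin n)) (MvPolynomial (Fin n × Fin n) K) :=
    { smul := fun σ f => rename (fun p : Fin n × Fin n => (σ p.1, σ p.2)) f
      one_smul := altOrbit_rename_diag_one
      mul_smul := altOrbit_rename_diag_mul }
  -- and of the permutations of `Ω := [n] ∖ X`, extended by the identity on `X`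
  letI instΩ : MulAction (Perm {x : Fin n // x ∉ X}) (MvPolynomial (Fin n × Fin n) K) :=
    MulAction.compHom _ (Perm.ofSubtype : Perm {x : Fin n // x ∉ X} →* Perm (Fin n))
  have hsmul : ∀ (τ : Perm {x : Fin n // x ∉ X}) (f : MvPolynomial (Fin n × Fin n) K),
      τ • f = rename (fun p : Fin n × Fin n => (ofSubtype τ p.1, ofSubtype τ p.2)) f :=
    fun _ _ => rfl
  have hcard : Fintype.card {x : Fin n // x ∉ X} = n - X.card := by
    rw [Fintype.card_subtype_compl, Fintype.card_fin, Fintype.card_coe]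
  have h5 : 5 ≤ Fintype.card {x : Fin n // x ∉ X} := by omega
  have hT' : T.card < Fintype.card {x : Fin n // x ∉ X} := by omega
  have horb' : ∀ τ : Perm {x : Fin n // x ∉ X}, sign τ = 1 → τ • q ∈ T := by
    intro τ hτ
    rw [hsmul]
    refine horb _ (fun x hx => ofSubtype_apply_of_not_mem τ (not_not.mpr hx)) ?_
    rw [sign_ofSubtype]
    exact hτ
  have key := altOrbit_smul_eq_of_alternating_orbit_small h5 q T hT' horb'
  -- restrict `ρ` to `Ω`
  have h₁ : ∀ x, ρ x ∉ X ↔ x ∉ X := by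
    intro x
    constructor
    · intro h hx
      exact h (by rwa [hρX x hx])
    · intro h hx
      have hfx : ρ x = x := ρ.injective (hρX _ hx)
      rw [hfx] at hx
      exact h hx
  have h₂ : ∀ x, ρ x ≠ x → x ∉ X := fun x hx hxX => hx (hρX x hxX)
  have hfix := key (ρ.subtypePerm h₁) (by rw [sign_subtypePerm ρ h₁ h₂]; exact hρs)
  rw [hsmul, ofSubtype_subtypePerm h₁ h₂] at hfix
  exact hfix

end Summit.ValiantsHypothesis.ValiantsHypothesis.Theorems
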